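import Literature.Computability.Cryptography.SequenceProblems
import HarnessLib

/-!
# Dynamic time warping: traversal bounds (tools for the SETH-hardness of DTW)

Elementary upper and lower bound principles for the dynamic time warping distance `dtwDist` of
`Literature.Computability.Cryptography.SequenceProblems` (integer sequences, local cost `|a - b|`,
values in `ℕ∞`), used by the alignment / coordinate gadgets of the reduction from Orthogonal
Vectors to one-dimensional DTW (K. Bringmann, M. Künnemann, *Quadratic conditional lower bounds for
string problems and dynamic time warping*, FOCS 2015, §3 and §6):

* explicit traversals (upper bounds): a sequence against a single point
  (`dtwDist_singleton_right/left`), absorbing a prefix by the other sequence's first point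
  (`dtwDist_append_cons_le`, `dtwDist_cons_append_le`), concatenating traversals
  (`dtwDist_append_append_le : dtwDist (A ++ B) (C ++ D) ≤ dtwDist A C + dtwDist B D`), constant
  sequences (`dtwDist_eq_zero_of_forall_eq`), finiteness on nonempty sequences (`dtwDist_ne_top`);
* **the potential principle** (lower bounds, `le_dtwDist_drop_of_local`): a function `Φ a b` on
  pairs of positions that vanishes at the end and satisfies the local inequality
  `Φ a b ≤ |x[a] - y[b]| + min (Φ (a+1) (b+1)) (min (Φ (a+1) b) (Φ a (b+1)))` is a lower bound for
  the distance of the suffixes, `Φ a b ≤ dtwDist (x.drop a) (y.drop b)` — the dynamic-programming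
  dual certificate that replaces arguments about optimal traversals.

## References

* K. Bringmann, M. Künnemann, FOCS 2015 (arXiv:1502.01063), §2 (traversals, DTW), §6.
-/

namespace Literature.Computability.FineGrained

open Cryptography

namespace DTWRed

/-! ### The local cost `|a - b|`

Costs are written `(((a - b).natAbs : ℕ) : ℕ∞)` throughout (no notation is introduced). -/

/-- The local cost is symmetric. [folklore] -/
theorem cost_comm (a b : ℤ) : ((a - b).natAbs : ℕ∞) = ((b - a).natAbs : ℕ∞) := by
  rw [← Int.natAbs_neg, neg_sub]

/-- The local cost of a point with itself vanishes. [folklore] -/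
theorem cost_self (a : ℤ) : ((a - a).natAbs : ℕ∞) = 0 := by simp

/-- A sum of local costs is the cast of the corresponding natural number. [folklore] -/
theorem sum_map_cost (P : List ℤ) (f : ℤ → ℤ) :
    (P.map fun p => ((p - f p).natAbs : ℕ∞)).sum = (((P.map fun p => (p - f p).natAbs).sum : ℕ) : ℕ∞) := by
  induction P with
  | nil => simp
  | cons p P ih => simp [ih]

/-- A sum of local costs is finite. [folklore] -/
theorem sum_map_cost_ne_top (P : List ℤ) (f : ℤ → ℤ) :
    (P.map fun p => ((p - f p).natAbs : ℕ∞)).sum ≠ ⊤ := by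
  rw [sum_map_cost]; exact WithTop.coe_ne_top

/-! ### A sequence against a single point -/

/-- Against a single point `c`, every point of a nonempty `L` is coupled with `c`:
`dtwDist L [c] = Σ_{v ∈ L} |v - c|`. [cite: BringmannKunnemannFOCS2015, §6 Lemma 6.4(1)] -/
theorem dtwDist_singleton_right : ∀ (L : List ℤ) (c : ℤ), L ≠ [] →
    dtwDist L [c] = (L.map fun v => ((v - c).natAbs : ℕ∞)).sum
  | [], _, h => (h rfl).elim
  | [v], c, _ => by
    rw [dtwDist_cons_cons]; simp
  | v :: v' :: L, c, _ => by
    rw [dtwDist_cons_cons, dtwDist_singleton_right (v' :: L) c (by simp)]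
    simp

/-- A single point `c` against a nonempty `L`: `dtwDist [c] L = Σ_{v ∈ L} |c - v|`. [folklore] -/
theorem dtwDist_singleton_left : ∀ (c : ℤ) (L : List ℤ), L ≠ [] →
    dtwDist [c] L = (L.map fun v => ((c - v).natAbs : ℕ∞)).sum
  | _, [], h => (h rfl).elim
  | c, [v], _ => by
    rw [dtwDist_cons_cons]; simp
  | c, v :: v' :: L, _ => by
    rw [dtwDist_cons_cons, dtwDist_singleton_left c (v' :: L) (by simp)]
    simp

/-! ### Absorbing a prefix by the other sequence's first point -/

/-- Couple every point of the prefix `P` with the first point `c` of the other sequence, then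
continue: `dtwDist (P ++ R) (c :: C) ≤ Σ_{p ∈ P} |p - c| + dtwDist R (c :: C)`. [folklore] -/
theorem dtwDist_append_cons_le : ∀ (P R : List ℤ) (c : ℤ) (C : List ℤ),
    dtwDist (P ++ R) (c :: C) ≤ (P.map fun p => ((p - c).natAbs : ℕ∞)).sum + dtwDist R (c :: C)
  | [], R, c, C => by simp
  | p :: P, R, c, C => by
    rw [List.cons_append, dtwDist_cons_cons, List.map_cons, List.sum_cons, add_assoc]
    refine add_le_add_right ?_ _
    exact (min_le_of_right_le (min_le_left _ _)).trans (dtwDist_append_cons_le P R c C)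

/-- Symmetric form: `dtwDist (c :: C) (P ++ R) ≤ Σ_{p ∈ P} |c - p| + dtwDist (c :: C) R`.
[folklore] -/
theorem dtwDist_cons_append_le : ∀ (c : ℤ) (C P R : List ℤ),
    dtwDist (c :: C) (P ++ R) ≤ (P.map fun p => ((c - p).natAbs : ℕ∞)).sum + dtwDist (c :: C) R
  | c, C, [], R => by simp
  | c, C, p :: P, R => by
    rw [List.cons_append, dtwDist_cons_cons, List.map_cons, List.sum_cons, add_assoc]
    refine add_le_add_right ?_ _
    exact (min_le_of_right_le (min_le_right _ _)).trans (dtwDist_cons_append_le c C P R)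

/-! ### Finiteness -/

/-- On two nonempty sequences the dynamic time warping distance is finite (couple everything
but the last point of the first sequence with the first point of the second, then the last point
with everything). [cite: BringmannKunnemannFOCS2015, §2] -/
theorem dtwDist_ne_top {A C : List ℤ} (hA : A ≠ []) (hC : C ≠ []) : dtwDist A C ≠ ⊤ := by
  obtain ⟨P, a, rfl⟩ : ∃ P a, A = P ++ [a] :=
    ⟨A.dropLast, A.getLast hA, (List.dropLast_append_getLast hA).symm⟩
  obtain ⟨c, C, rfl⟩ := List.exists_cons_of_ne_nil hC
  refine ne_top_of_le_ne_top ?_ (dtwDist_append_cons_le P [a] c C)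
  rw [dtwDist_singleton_left a (c :: C) (by simp)]
  have h2 : ((c :: C).map fun v => ((a - v).natAbs : ℕ∞)).sum ≠ ⊤ := by
    have := sum_map_cost_ne_top (c :: C) (fun _ => a)
    rwa [List.map_congr_left (fun v _ => cost_comm v a)] at this
  exact WithTop.add_ne_top.2 ⟨sum_map_cost_ne_top P fun _ => c, h2⟩

/-! ### Concatenating traversals -/

/-- **Concatenation of traversals.** A traversal of `(A, C)` followed by one of `(B, D)` is a
traversal of `(A ++ B, C ++ D)`: `dtwDist (A ++ B) (C ++ D) ≤ dtwDist A C + dtwDist B D`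
(unconditionally: if exactly one of `A`, `C` — or of `B`, `D` — is empty the right-hand side is
`⊤`). [cite: BringmannKunnemannFOCS2015, §6 (proof of Lemma 6.3, the traversal of Fig. 4)] -/
theorem dtwDist_append_append_le : ∀ (A B C D : List ℤ),
    dtwDist (A ++ B) (C ++ D) ≤ dtwDist A C + dtwDist B D
  | [], B, [], D => by simp
  | [], B, c :: C, D => by simp
  | a :: A, B, [], D => by simp
  | a :: A, B, c :: C, D => by
    rw [List.cons_append, List.cons_append, dtwDist_cons_cons, dtwDist_cons_cons, add_assoc]
    refine add_le_add_right ?_ _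
    rw [← min_add_add_right, ← min_add_add_right]
    have h₁ := dtwDist_append_append_le A B C D
    have h₂ := dtwDist_append_append_le A B (c :: C) D
    have h₃ := dtwDist_append_append_le (a :: A) B C D
    rw [List.cons_append] at h₂ h₃
    exact min_le_min h₁ (min_le_min h₂ h₃)
termination_by A _ C _ => A.length + C.length

/-! ### One-step bounds and the diagonal traversal -/

/-- Diagonal step: `dtwDist (a :: A) (c :: C) ≤ |a - c| + dtwDist A C`. [folklore] -/
theorem dtwDist_cons_cons_le_diag (a c : ℤ) (A C : List ℤ) :
    dtwDist (a :: A) (c :: C) ≤ ((a - c).natAbs : ℕ∞) + dtwDist A C := by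
  rw [dtwDist_cons_cons]; exact add_le_add_right (min_le_left _ _) _

/-- Advancing in the first sequence only: `dtwDist (a :: A) (c :: C) ≤ |a - c| + dtwDist A (c :: C)`.
[folklore] -/
theorem dtwDist_cons_cons_le_left (a c : ℤ) (A C : List ℤ) :
    dtwDist (a :: A) (c :: C) ≤ ((a - c).natAbs : ℕ∞) + dtwDist A (c :: C) := by
  rw [dtwDist_cons_cons]; exact add_le_add_right (min_le_of_right_le (min_le_left _ _)) _

/-- Advancing in the second sequence only: `dtwDist (a :: A) (c :: C) ≤ |a - c| + dtwDist (a :: A) C`.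
[folklore] -/
theorem dtwDist_cons_cons_le_right (a c : ℤ) (A C : List ℤ) :
    dtwDist (a :: A) (c :: C) ≤ ((a - c).natAbs : ℕ∞) + dtwDist (a :: A) C := by
  rw [dtwDist_cons_cons]; exact add_le_add_right (min_le_of_right_le (min_le_right _ _)) _

/-- **The diagonal traversal** of two sequences of the same length couples the `k`-th points:
`dtwDist A C ≤ Σ_k |A[k] - C[k]|`. [folklore] -/
theorem dtwDist_le_sum_zipWith : ∀ (A C : List ℤ), A.length = C.length →
    dtwDist A C ≤ (List.zipWith (fun a c => ((a - c).natAbs : ℕ∞)) A C).sum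
  | [], [], _ => by simp
  | [], _ :: _, h => by simp at h
  | _ :: _, [], h => by simp at h
  | [a], [c], _ => by rw [dtwDist_cons_cons]; simp
  | [_], _ :: _ :: _, h => by simp at h
  | _ :: _ :: _, [_], h => by simp at h
  | a :: a' :: A, c :: c' :: C, h => by
    rw [List.zipWith_cons_cons, List.sum_cons]
    refine (dtwDist_cons_cons_le_diag a c _ _).trans (add_le_add_right ?_ _)
    exact dtwDist_le_sum_zipWith (a' :: A) (c' :: C) (by simpa using h)

/-- Splitting the first sequence at `t`: couple its first `t` points with the first point of the
other sequence, then continue with the rest: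
`dtwDist X (c :: C) ≤ Σ_{v ∈ X.take t} |v - c| + dtwDist (X.drop t) (c :: C)`. [folklore] -/
theorem dtwDist_le_sum_take_add_drop (X : List ℤ) (t : ℕ) (c : ℤ) (C : List ℤ) :
    dtwDist X (c :: C) ≤ ((X.take t).map fun v => ((v - c).natAbs : ℕ∞)).sum + dtwDist (X.drop t) (c :: C) := by
  conv_lhs => rw [← List.take_append_drop t X]
  exact dtwDist_append_cons_le _ _ _ _

/-- Symmetric splitting of the second sequence at `u`:
`dtwDist (a :: A) Y ≤ Σ_{v ∈ Y.take u} |a - v| + dtwDist (a :: A) (Y.drop u)`. [folklore] -/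
theorem dtwDist_le_sum_take_add_drop_right (a : ℤ) (A Y : List ℤ) (u : ℕ) :
    dtwDist (a :: A) Y ≤ ((Y.take u).map fun v => ((a - v).natAbs : ℕ∞)).sum + dtwDist (a :: A) (Y.drop u) := by
  conv_lhs => rw [← List.take_append_drop u Y]
  exact dtwDist_cons_append_le _ _ _ _

/-! ### Constant sequences -/

/-- Two nonempty sequences all of whose points equal one value are at distance `0`.
[folklore] -/
theorem dtwDist_eq_zero_of_forall_eq (A C : List ℤ) (v : ℤ) (hA : A ≠ []) (hC : C ≠ [])
    (hAv : ∀ a ∈ A, a = v) (hCv : ∀ c ∈ C, c = v) : dtwDist A C = 0 := by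
  obtain ⟨P, a, rfl⟩ : ∃ P a, A = P ++ [a] :=
    ⟨A.dropLast, A.getLast hA, (List.dropLast_append_getLast hA).symm⟩
  obtain ⟨c, C, rfl⟩ := List.exists_cons_of_ne_nil hC
  refine nonpos_iff_eq_zero.1 ?_
  refine (dtwDist_append_cons_le P [a] c C).trans ?_
  rw [dtwDist_singleton_left a (c :: C) (by simp)]
  have hP : (P.map fun p => ((p - c).natAbs : ℕ∞)).sum = 0 := by
    refine List.sum_eq_zero fun w hw => ?_
    obtain ⟨p, hp, rfl⟩ := List.mem_map.1 hw
    rw [hAv p (by simp [hp]), hCv c (by simp), cost_self]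
  have hC' : ((c :: C).map fun w => ((a - w).natAbs : ℕ∞)).sum = 0 := by
    refine List.sum_eq_zero fun w hw => ?_
    obtain ⟨q, hq, rfl⟩ := List.mem_map.1 hw
    rw [hAv a (by simp), hCv q hq, cost_self]
  rw [hP, hC', zero_add]

/-- In particular blocks `M^a` and `M^b` (`a, b ≥ 1`) are at distance `0`. [folklore] -/
theorem dtwDist_replicate_replicate (M : ℤ) {a b : ℕ} (ha : a ≠ 0) (hb : b ≠ 0) :
    dtwDist (List.replicate a M) (List.replicate b M) = 0 :=
  dtwDist_eq_zero_of_forall_eq _ _ M (by simpa using ha) (by simpa using hb)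
    (fun _ h => List.eq_of_mem_replicate h) (fun _ h => List.eq_of_mem_replicate h)

/-! ### The potential principle (lower bounds) -/

/-- **The potential principle for DTW lower bounds.** Let `Φ a b : ℕ∞` be defined on pairs of
positions of `x` and `y`, vanish at `(|x|, |y|)`, and satisfy at every pair of proper positions
the local inequality of the dynamic programme,
`Φ a b ≤ |x[a] - y[b]| + min (Φ (a+1) (b+1)) (min (Φ (a+1) b) (Φ a (b+1)))`.
Then `Φ a b ≤ dtwDist (x.drop a) (y.drop b)` for all `a ≤ |x|`, `b ≤ |y|` (states with exactly
one sequence exhausted have distance `⊤`, so no hypothesis is needed there). Proof: induction on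
the total remaining length along the defining recursion of `dtwDist`. [folklore] -/
theorem le_dtwDist_drop_of_local (x y : List ℤ) (Φ : ℕ → ℕ → ℕ∞)
    (hend : Φ x.length y.length = 0)
    (hstep : ∀ (a b : ℕ) (ha : a < x.length) (hb : b < y.length),
      Φ a b ≤ ((x[a] - y[b]).natAbs : ℕ∞) + min (Φ (a + 1) (b + 1)) (min (Φ (a + 1) b) (Φ a (b + 1)))) :
    ∀ a b, a ≤ x.length → b ≤ y.length → Φ a b ≤ dtwDist (x.drop a) (y.drop b) := by
  suffices H : ∀ k a b, a ≤ x.length → b ≤ y.length → (x.length - a) + (y.length - b) = k →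
      Φ a b ≤ dtwDist (x.drop a) (y.drop b) from
    fun a b ha hb => H _ a b ha hb rfl
  intro k
  induction k using Nat.strong_induction_on with
  | _ k ih =>
    intro a b ha hb hk
    rcases ha.lt_or_eq with ha' | rfl <;> rcases hb.lt_or_eq with hb' | rfl
    · rw [List.drop_eq_getElem_cons ha', List.drop_eq_getElem_cons hb', dtwDist_cons_cons]
      refine (hstep a b ha' hb').trans (add_le_add_right ?_ _)
      refine min_le_min ?_ (min_le_min ?_ ?_)
      · exact ih _ (by omega) (a + 1) (b + 1) ha' hb' rfl
      · have := ih _ (by omega) (a + 1) b ha' hb rfl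
        rwa [List.drop_eq_getElem_cons hb'] at this
      · have := ih _ (by omega) a (b + 1) ha hb' rfl
        rwa [List.drop_eq_getElem_cons ha'] at this
    · rw [List.drop_eq_getElem_cons ha', List.drop_eq_nil_of_le (le_refl y.length), dtwDist_cons_nil]
      exact le_top
    · rw [List.drop_eq_nil_of_le (le_refl x.length), List.drop_eq_getElem_cons hb', dtwDist_nil_cons]
      exact le_top
    · rw [List.drop_eq_nil_of_le (le_refl x.length), List.drop_eq_nil_of_le (le_refl y.length),
        dtwDist_nil_nil, hend]

/-- The potential principle at the start: `Φ 0 0 ≤ dtwDist x y`. [folklore] -/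
theorem le_dtwDist_of_local (x y : List ℤ) (Φ : ℕ → ℕ → ℕ∞)
    (hend : Φ x.length y.length = 0)
    (hstep : ∀ (a b : ℕ) (ha : a < x.length) (hb : b < y.length),
      Φ a b ≤ ((x[a] - y[b]).natAbs : ℕ∞) + min (Φ (a + 1) (b + 1)) (min (Φ (a + 1) b) (Φ a (b + 1)))) :
    Φ 0 0 ≤ dtwDist x y := by
  simpa using le_dtwDist_drop_of_local x y Φ hend hstep 0 0 (Nat.zero_le _) (Nat.zero_le _)

end DTWRed

end Literature.Computability.FineGrained
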